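import Literature.Computability.AlgebraicComplexity.QuantumFunctionalsUpperKronecker
import Literature.RepresentationTheory.FiniteGroups.SymmetricGroupIsotypic
import HarnessLib

/-!
# The isotypic decomposition of tensor powers in coordinates: discharge of
# `sum_isotypicSum_eq_self` (CVZ §3.1 (sw))

Topic `Literature/Computability/AlgebraicComplexity`; proofs file for the named fact
`sum_isotypicSum_eq_self` of `QuantumFunctionalsUpperKronecker.lean` (the isotypic decomposition
`∑_{λ ⊢ n} P_λ^{V_j} = id` of the `S_n`-module `(V₁ ⊗ V₂ ⊗ V₃)^{⊗n}`, `S_n` permuting the legs of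
the factor `j`; Christandl–Vrana–Zuiddam, J. Amer. Math. Soc. 36 (2023), §3.1 display (sw), with
Fulton–Harris (2.32)). It is a special case of the tree's general theorem
`Literature.RepresentationTheory.FiniteGroups.sum_isotypicProj_specht`
(`SymmetricGroupIsotypic.lean`: for every finite-dimensional complex representation `ρ` of
`𝔖ₙ`, `∑_{μ ⊢ n} P_μ = 1` with Serre's projectors `P_μ = (χ^μ(1)/n!) ∑_t χ^μ(t) ρ(t⁻¹)`,
Serre §2.6 Thm. 8), once

* the leg actions `permLegsⱼ` are packaged as representations `permLegsRepⱼ` of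
  `𝔖ₙ = Equiv.Perm (Fin n)` on the coordinate space
  `(Fin n → ι) → (Fin n → κ) → (Fin n → μ) → ℂ` (§2), for which
  `P_λ = (χ_λ(1)/n!) • isotypicSumⱼ λ` (`isotypicProj_permLegsRepⱼ`, using `χ_λ(t⁻¹) = χ_λ(t)`);
* the statement is transported from index types in `Type` (the universe of the tree's
  character theory) to index types in an arbitrary universe by re-indexing the alphabets along
  `Fintype.equivFin` (§1: `reindexPow`, which commutes with the leg actions, the isotypic sums
  and the outer products `outerPow`, and is injective).

Main result: `sum_isotypicSum_eq_self_holds`. The re-indexing lemmas of §1 serve the other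
discharges of this decomposition (Kronecker restriction rule, Schur–Weyl vanishing) as well.

## References

* M. Christandl, P. Vrana, J. Zuiddam, J. Amer. Math. Soc. 36 (2023) = arXiv:1709.07851v3,
  §3.1 (sw). [ChristandlVranaZuiddam2023]
* J.-P. Serre, *Linear Representations of Finite Groups*, GTM 42, §2.6 Thm. 8.
  [SerreLinearRepresentations1977]
* W. Fulton, J. Harris, *Representation Theory*, GTM 129, (2.32) and Thm. 4.3. [FultonHarrisGTM129]
-/

noncomputable section

open scoped BigOperators

namespace Literature.Computability.AlgebraicComplexity

open Literature.NumberTheory.DiophantineGeometry (spechtCharacter)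
open Literature.RepresentationTheory.FiniteGroups (isotypicProj isotypicProj_apply
  sum_isotypicProj_specht_apply)

universe u

/-! ## §1 Re-indexing the alphabets -/

section Reindex

variable {K : Type*} {ι κ μ ι₀ κ₀ μ₀ ι' κ' μ' ι₀' κ₀' μ₀' : Type*} {n : ℕ}

/-- Re-indexing the three alphabets of an `n`-fold tensor power along bijections
`ι ≃ ι₀`, `κ ≃ κ₀`, `μ ≃ μ₀` (the isomorphism `(ℂ^ι ⊗ ℂ^κ ⊗ ℂ^μ)^{⊗n} ≅ (ℂ^{ι₀} ⊗ ℂ^{κ₀} ⊗ ℂ^{μ₀})^{⊗n}`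
induced by renaming basis vectors; it commutes with everything `S_n` does to the legs).
[folklore] -/
def reindexPow (eι : ι ≃ ι₀) (eκ : κ ≃ κ₀) (eμ : μ ≃ μ₀)
    (u : (Fin n → ι) → (Fin n → κ) → (Fin n → μ) → K) :
    (Fin n → ι₀) → (Fin n → κ₀) → (Fin n → μ₀) → K :=
  fun a b c => u (eι.symm ∘ a) (eκ.symm ∘ b) (eμ.symm ∘ c)

/-- Unfolding of `reindexPow`. [folklore] -/
@[simp] theorem reindexPow_apply (eι : ι ≃ ι₀) (eκ : κ ≃ κ₀) (eμ : μ ≃ μ₀)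
    (u : (Fin n → ι) → (Fin n → κ) → (Fin n → μ) → K) (a : Fin n → ι₀) (b : Fin n → κ₀)
    (c : Fin n → μ₀) :
    reindexPow eι eκ eμ u a b c = u (eι.symm ∘ a) (eκ.symm ∘ b) (eμ.symm ∘ c) := rfl

/-- Re-indexing back along the inverse bijections is the identity. [folklore] -/
theorem reindexPow_symm_reindexPow (eι : ι ≃ ι₀) (eκ : κ ≃ κ₀) (eμ : μ ≃ μ₀)
    (u : (Fin n → ι) → (Fin n → κ) → (Fin n → μ) → K) :
    reindexPow eι.symm eκ.symm eμ.symm (reindexPow eι eκ eμ u) = u := by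
  funext a b c
  simp only [reindexPow_apply, Equiv.symm_symm, ← Function.comp_assoc, Equiv.symm_comp_self,
    Function.id_comp]

/-- Re-indexing is injective. [folklore] -/
theorem reindexPow_injective (eι : ι ≃ ι₀) (eκ : κ ≃ κ₀) (eμ : μ ≃ μ₀) :
    Function.Injective
      (reindexPow (K := K) (n := n) eι eκ eμ) :=
  Function.LeftInverse.injective (reindexPow_symm_reindexPow eι eκ eμ)

/-- Re-indexing the zero tensor gives zero. [folklore] -/
@[simp] theorem reindexPow_zero [Zero K] (eι : ι ≃ ι₀) (eκ : κ ≃ κ₀) (eμ : μ ≃ μ₀) :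
    reindexPow eι eκ eμ (0 : (Fin n → ι) → (Fin n → κ) → (Fin n → μ) → K) = 0 := rfl

/-- A tensor is nonzero iff its re-indexing is. [folklore] -/
theorem reindexPow_ne_zero_iff [Zero K] (eι : ι ≃ ι₀) (eκ : κ ≃ κ₀) (eμ : μ ≃ μ₀)
    (u : (Fin n → ι) → (Fin n → κ) → (Fin n → μ) → K) :
    reindexPow eι eκ eμ u ≠ 0 ↔ u ≠ 0 := by
  rw [Ne, Ne, ← reindexPow_zero (K := K) (n := n) eι eκ eμ,
    (reindexPow_injective eι eκ eμ).eq_iff]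

/-- Re-indexing is linear: it commutes with finite linear combinations. [folklore] -/
theorem reindexPow_sum_smul [CommSemiring K] {α : Type*} (s : Finset α) (c : α → K)
    (w : α → (Fin n → ι) → (Fin n → κ) → (Fin n → μ) → K) (eι : ι ≃ ι₀) (eκ : κ ≃ κ₀)
    (eμ : μ ≃ μ₀) :
    reindexPow eι eκ eμ (∑ i ∈ s, c i • w i) = ∑ i ∈ s, c i • reindexPow eι eκ eμ (w i) := by
  funext a b c'
  simp only [reindexPow_apply, Finset.sum_apply, Pi.smul_apply]

/-- Re-indexing commutes with the leg action on the first factor. [folklore] -/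
theorem reindexPow_permLegs₁ (eι : ι ≃ ι₀) (eκ : κ ≃ κ₀) (eμ : μ ≃ μ₀) (π : Equiv.Perm (Fin n))
    (u : (Fin n → ι) → (Fin n → κ) → (Fin n → μ) → K) :
    reindexPow eι eκ eμ (permLegs₁ π u) = permLegs₁ π (reindexPow eι eκ eμ u) := rfl

/-- Re-indexing commutes with the leg action on the second factor. [folklore] -/
theorem reindexPow_permLegs₂ (eι : ι ≃ ι₀) (eκ : κ ≃ κ₀) (eμ : μ ≃ μ₀) (π : Equiv.Perm (Fin n))
    (u : (Fin n → ι) → (Fin n → κ) → (Fin n → μ) → K) :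
    reindexPow eι eκ eμ (permLegs₂ π u) = permLegs₂ π (reindexPow eι eκ eμ u) := rfl

/-- Re-indexing commutes with the leg action on the third factor. [folklore] -/
theorem reindexPow_permLegs₃ (eι : ι ≃ ι₀) (eκ : κ ≃ κ₀) (eμ : μ ≃ μ₀) (π : Equiv.Perm (Fin n))
    (u : (Fin n → ι) → (Fin n → κ) → (Fin n → μ) → K) :
    reindexPow eι eκ eμ (permLegs₃ π u) = permLegs₃ π (reindexPow eι eκ eμ u) := rfl

/-- Re-indexing commutes with the isotypic character sum on the first factor. [folklore] -/
theorem reindexPow_isotypicSum₁ (eι : ι ≃ ι₀) (eκ : κ ≃ κ₀) (eμ : μ ≃ μ₀) (lam : Nat.Partition n)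
    (u : (Fin n → ι) → (Fin n → κ) → (Fin n → μ) → ℂ) :
    reindexPow eι eκ eμ (isotypicSum₁ lam u) = isotypicSum₁ lam (reindexPow eι eκ eμ u) := by
  unfold isotypicSum₁
  rw [reindexPow_sum_smul]
  rfl

/-- Re-indexing commutes with the isotypic character sum on the second factor. [folklore] -/
theorem reindexPow_isotypicSum₂ (eι : ι ≃ ι₀) (eκ : κ ≃ κ₀) (eμ : μ ≃ μ₀) (lam : Nat.Partition n)
    (u : (Fin n → ι) → (Fin n → κ) → (Fin n → μ) → ℂ) :
    reindexPow eι eκ eμ (isotypicSum₂ lam u) = isotypicSum₂ lam (reindexPow eι eκ eμ u) := by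
  unfold isotypicSum₂
  rw [reindexPow_sum_smul]
  rfl

/-- Re-indexing commutes with the isotypic character sum on the third factor. [folklore] -/
theorem reindexPow_isotypicSum₃ (eι : ι ≃ ι₀) (eκ : κ ≃ κ₀) (eμ : μ ≃ μ₀) (lam : Nat.Partition n)
    (u : (Fin n → ι) → (Fin n → κ) → (Fin n → μ) → ℂ) :
    reindexPow eι eκ eμ (isotypicSum₃ lam u) = isotypicSum₃ lam (reindexPow eι eκ eμ u) := by
  unfold isotypicSum₃
  rw [reindexPow_sum_smul]
  rfl

/-- Re-indexing commutes with the leg isotypic sums `legIsotypicSum j`. [folklore] -/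
theorem reindexPow_legIsotypicSum (eι : ι ≃ ι₀) (eκ : κ ≃ κ₀) (eμ : μ ≃ μ₀) (j : Fin 3)
    (lam : Nat.Partition n) (u : (Fin n → ι) → (Fin n → κ) → (Fin n → μ) → ℂ) :
    reindexPow eι eκ eμ (legIsotypicSum j lam u) = legIsotypicSum j lam (reindexPow eι eκ eμ u) := by
  match j with
  | 0 => exact reindexPow_isotypicSum₁ eι eκ eμ lam u
  | 1 => exact reindexPow_isotypicSum₂ eι eκ eμ lam u
  | 2 => exact reindexPow_isotypicSum₃ eι eκ eμ lam u

/-- Re-indexing commutes with outer products (product bijections on the product alphabets).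
[folklore] -/
theorem reindexPow_outerPow [Mul K] (eι : ι ≃ ι₀) (eκ : κ ≃ κ₀) (eμ : μ ≃ μ₀) (eι' : ι' ≃ ι₀')
    (eκ' : κ' ≃ κ₀') (eμ' : μ' ≃ μ₀') (u : (Fin n → ι) → (Fin n → κ) → (Fin n → μ) → K)
    (v : (Fin n → ι') → (Fin n → κ') → (Fin n → μ') → K) :
    reindexPow (eι.prodCongr eι') (eκ.prodCongr eκ') (eμ.prodCongr eμ') (outerPow u v) =
      outerPow (reindexPow eι eκ eμ u) (reindexPow eι' eκ' eμ' v) := rfl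

end Reindex

/-! ## §2 The leg actions as representations of `𝔖ₙ` -/

section Rep

variable {ι κ μ : Type*} {n : ℕ}

/-- The leg action of `𝔖ₙ` on the first factor of `(ℂ^ι ⊗ ℂ^κ ⊗ ℂ^μ)^{⊗n}`, as a complex
representation (CVZ §3.1: `S_n` acting on `V_S^{⊗n}`, `S = {1}`).
[cite: ChristandlVranaZuiddam2023, §3.1] -/
def permLegsRep₁ : Representation ℂ (Equiv.Perm (Fin n))
    ((Fin n → ι) → (Fin n → κ) → (Fin n → μ) → ℂ) where
  toFun π :=
    { toFun := permLegs₁ π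
      map_add' := fun _ _ => rfl
      map_smul' := fun _ _ => rfl }
  map_one' := LinearMap.ext fun _ => rfl
  map_mul' _ _ := LinearMap.ext fun _ => rfl

/-- The leg action of `𝔖ₙ` on the second factor, as a complex representation.
[cite: ChristandlVranaZuiddam2023, §3.1] -/
def permLegsRep₂ : Representation ℂ (Equiv.Perm (Fin n))
    ((Fin n → ι) → (Fin n → κ) → (Fin n → μ) → ℂ) where
  toFun π :=
    { toFun := permLegs₂ π
      map_add' := fun _ _ => rfl
      map_smul' := fun _ _ => rfl }
  map_one' := LinearMap.ext fun _ => rfl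
  map_mul' _ _ := LinearMap.ext fun _ => rfl

/-- The leg action of `𝔖ₙ` on the third factor, as a complex representation.
[cite: ChristandlVranaZuiddam2023, §3.1] -/
def permLegsRep₃ : Representation ℂ (Equiv.Perm (Fin n))
    ((Fin n → ι) → (Fin n → κ) → (Fin n → μ) → ℂ) where
  toFun π :=
    { toFun := permLegs₃ π
      map_add' := fun _ _ => rfl
      map_smul' := fun _ _ => rfl }
  map_one' := LinearMap.ext fun _ => rfl
  map_mul' _ _ := LinearMap.ext fun _ => rfl

/-- `permLegsRep₁ π = permLegs₁ π`. [folklore] -/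
@[simp] theorem permLegsRep₁_apply (π : Equiv.Perm (Fin n))
    (u : (Fin n → ι) → (Fin n → κ) → (Fin n → μ) → ℂ) : permLegsRep₁ π u = permLegs₁ π u := rfl

/-- `permLegsRep₂ π = permLegs₂ π`. [folklore] -/
@[simp] theorem permLegsRep₂_apply (π : Equiv.Perm (Fin n))
    (u : (Fin n → ι) → (Fin n → κ) → (Fin n → μ) → ℂ) : permLegsRep₂ π u = permLegs₂ π u := rfl

/-- `permLegsRep₃ π = permLegs₃ π`. [folklore] -/
@[simp] theorem permLegsRep₃_apply (π : Equiv.Perm (Fin n))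
    (u : (Fin n → ι) → (Fin n → κ) → (Fin n → μ) → ℂ) : permLegsRep₃ π u = permLegs₃ π u := rfl

/-- `|𝔖ₙ| = n!` as a complex number. [folklore] -/
theorem card_perm_fin_cast (n : ℕ) :
    ((Fintype.card (Equiv.Perm (Fin n)) : ℕ) : ℂ) = (n.factorial : ℂ) := by
  rw [Fintype.card_perm, Fintype.card_fin]

/-- **Serre's projector is the normalised isotypic character sum**: on the first-leg
representation, `P_λ = (χ_λ(1)/n!) ∑_t χ_λ(t) ρ(t⁻¹) = (χ_λ(1)/n!) • isotypicSum₁ λ`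
(re-index `t ↦ t⁻¹` and use `χ_λ(t⁻¹) = χ_λ(t)` on `𝔖ₙ`).
[cite: SerreLinearRepresentations1977, §2.6 Thm. 8] -/
theorem isotypicProj_permLegsRep₁ (lam : Nat.Partition n)
    (u : (Fin n → ι) → (Fin n → κ) → (Fin n → μ) → ℂ) :
    isotypicProj permLegsRep₁ (spechtCharacter ℂ lam) u =
      (spechtCharacter ℂ lam 1 / (n.factorial : ℂ)) • isotypicSum₁ lam u := by
  rw [isotypicProj_apply, card_perm_fin_cast, isotypicSum₁, Finset.smul_sum]
  refine Fintype.sum_equiv (Equiv.inv _) _ _ fun t => ?_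
  rw [Equiv.inv_apply, permLegsRep₁_apply, mul_smul,
    ← Literature.RepresentationTheory.FiniteGroups.spechtCharacter_inv lam t]

/-- Same on the second factor. [cite: SerreLinearRepresentations1977, §2.6 Thm. 8] -/
theorem isotypicProj_permLegsRep₂ (lam : Nat.Partition n)
    (u : (Fin n → ι) → (Fin n → κ) → (Fin n → μ) → ℂ) :
    isotypicProj permLegsRep₂ (spechtCharacter ℂ lam) u =
      (spechtCharacter ℂ lam 1 / (n.factorial : ℂ)) • isotypicSum₂ lam u := by
  rw [isotypicProj_apply, card_perm_fin_cast, isotypicSum₂, Finset.smul_sum]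
  refine Fintype.sum_equiv (Equiv.inv _) _ _ fun t => ?_
  rw [Equiv.inv_apply, permLegsRep₂_apply, mul_smul,
    ← Literature.RepresentationTheory.FiniteGroups.spechtCharacter_inv lam t]

/-- Same on the third factor. [cite: SerreLinearRepresentations1977, §2.6 Thm. 8] -/
theorem isotypicProj_permLegsRep₃ (lam : Nat.Partition n)
    (u : (Fin n → ι) → (Fin n → κ) → (Fin n → μ) → ℂ) :
    isotypicProj permLegsRep₃ (spechtCharacter ℂ lam) u =
      (spechtCharacter ℂ lam 1 / (n.factorial : ℂ)) • isotypicSum₃ lam u := by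
  rw [isotypicProj_apply, card_perm_fin_cast, isotypicSum₃, Finset.smul_sum]
  refine Fintype.sum_equiv (Equiv.inv _) _ _ fun t => ?_
  rw [Equiv.inv_apply, permLegsRep₃_apply, mul_smul,
    ← Literature.RepresentationTheory.FiniteGroups.spechtCharacter_inv lam t]

end Rep

/-! ## §3 Discharge of `sum_isotypicSum_eq_self` -/

section Discharge

/-- The isotypic decomposition for alphabets in `Type`: a direct specialisation of
`sum_isotypicProj_specht` (`∑_{μ ⊢ n} P_μ = 1` on any finite-dimensional representation of
`𝔖ₙ`, Serre §2.6 Thm. 8) to the three leg representations.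
[cite: SerreLinearRepresentations1977, §2.6 Thm. 8] -/
theorem sum_isotypicSum_eq_self_type {ι κ μ : Type} [Fintype ι] [Fintype κ] [Fintype μ] {n : ℕ}
    (u : (Fin n → ι) → (Fin n → κ) → (Fin n → μ) → ℂ) :
    (∑ lam : Nat.Partition n,
        (spechtCharacter ℂ lam 1 / (n.factorial : ℂ)) • isotypicSum₁ lam u = u) ∧
    (∑ lam : Nat.Partition n,
        (spechtCharacter ℂ lam 1 / (n.factorial : ℂ)) • isotypicSum₂ lam u = u) ∧
    (∑ lam : Nat.Partition n,
        (spechtCharacter ℂ lam 1 / (n.factorial : ℂ)) • isotypicSum₃ lam u = u) := by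
  classical
  refine ⟨?_, ?_, ?_⟩
  · have h := sum_isotypicProj_specht_apply (permLegsRep₁ (ι := ι) (κ := κ) (μ := μ) (n := n)) u
    simpa only [isotypicProj_permLegsRep₁] using h
  · have h := sum_isotypicProj_specht_apply (permLegsRep₂ (ι := ι) (κ := κ) (μ := μ) (n := n)) u
    simpa only [isotypicProj_permLegsRep₂] using h
  · have h := sum_isotypicProj_specht_apply (permLegsRep₃ (ι := ι) (κ := κ) (μ := μ) (n := n)) u
    simpa only [isotypicProj_permLegsRep₃] using h

/-- **Discharge of `sum_isotypicSum_eq_self`** (the isotypic decomposition (sw) of CVZ §3.1 in the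
coordinates of `QuantumFunctionalsUpper.lean`), in every universe: re-index the alphabets along
`Fintype.equivFin` into `Type`, apply `sum_isotypicSum_eq_self_type`, and pull back along the
injective re-indexing. [cite: ChristandlVranaZuiddam2023, §3.1 (sw)] -/
theorem sum_isotypicSum_eq_self_holds : sum_isotypicSum_eq_self.{u} := by
  intro ι κ μ _ _ _ n u
  set eι := Fintype.equivFin ι
  set eκ := Fintype.equivFin κ
  set eμ := Fintype.equivFin μ
  obtain ⟨h₁, h₂, h₃⟩ := sum_isotypicSum_eq_self_type (reindexPow eι eκ eμ u)
  refine ⟨reindexPow_injective eι eκ eμ ?_, reindexPow_injective eι eκ eμ ?_,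
    reindexPow_injective eι eκ eμ ?_⟩
  · rw [reindexPow_sum_smul]
    simpa only [reindexPow_isotypicSum₁] using h₁
  · rw [reindexPow_sum_smul]
    simpa only [reindexPow_isotypicSum₂] using h₂
  · rw [reindexPow_sum_smul]
    simpa only [reindexPow_isotypicSum₃] using h₃

end Discharge

end Literature.Computability.AlgebraicComplexity

end
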